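import Mathlib
import Literature.Analysis.Convexity.AnisotropicPerimeterLevelPieces
import HarnessLib

/-!
# Super-level sets of piecewise-affine functions on polytopal complexes of `ℝ³`, II: the level facet

Topic `Literature/Analysis/Convexity`; namespace `Literature.Analysis.Convexity`.  Setting as in
`AnisotropicPerimeterLevelPieces.lean` (one cell `Q = ⋂_{p ∈ H} {⟪p.1, ·⟫ < p.2}`, `f = ⟪g, ·⟫ + b`
on `closure Q`, `g ≠ 0`).

* `volume_chartPreimage_openLevelFacet_eq_volume_prism` — for a NONEMPTY piece `Q ∩ {f > t}`, the
  open facet of the normalised level constraint `ℓ`, read in an isometric chart of the level plane,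
  has the area of the closed level face `closure Q ∩ {f = t}` written (as everywhere in the facet
  toolkit) as the volume of the unit prism erected on it along the outer level normal `-g/‖g‖`;
* `volume_prism_levelFacet_eq_zero_of_inter_eq_empty` — for an EMPTY piece in general position
  (the level plane is not a facet plane of the cell) that prism is Lebesgue-null: the face
  `closure Q ∩ {f = t}` lies in finitely many lines of the level plane.

[cite: Maggi2012, (20.2) p. 258 and Remark 20.3 (anisotropic perimeter of polyhedral sets as facet
sums); EvansGariepy2015, §5 Thm 5.16 (Gauss–Green) and §3.4.4 Thm 3.13 (level sets) — here the
elementary polyhedral / piecewise-affine case]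
-/

noncomputable section

namespace Literature.Analysis.Convexity

open _root_.MeasureTheory Set Filter
open scoped RealInnerProductSpace Topology ENNReal
open Literature.MeasureTheory.Integral

/-! ### The level facet of one cell -/

/-- **Chart area of the open level facet = prism volume over the closed level facet.**  For a cell
`Q = ⋂_{p ∈ H} {⟪p.1, ·⟫ < p.2}` with `f = ⟪g, ·⟫ + b` on `closure Q`, `g ≠ 0`, a NONEMPTY piece
`Q ∩ {f > t}`, the normalised level constraint `ℓ = (‖-g‖⁻¹ • (-g), ‖-g‖⁻¹ (b - t))` and an
orthonormal frame `(U, V, ℓ.1)`: the open facet of `ℓ` in the piece, read in the chart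
`y ↦ ℓ.2 ℓ.1 + y₁ U + y₂ V`, has the area of `closure Q ∩ {f = t}` written as the volume of the unit
prism along `-g/‖g‖`. [cite: Maggi2012, Remark 20.3 p. 258; EvansGariepy2015, Thm 5.16 — plumbing] -/
theorem volume_chartPreimage_openLevelFacet_eq_volume_prism
    (H : Finset (EuclideanSpace ℝ (Fin 3) × ℝ)) {Q : Set (EuclideanSpace ℝ (Fin 3))}
    (hQ : Q = ⋂ p ∈ H, {x : EuclideanSpace ℝ (Fin 3) | ⟪p.1, x⟫ < p.2})
    (g : EuclideanSpace ℝ (Fin 3)) (hg : g ≠ 0) (b t : ℝ) {f : EuclideanSpace ℝ (Fin 3) → ℝ}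
    (hf : ∀ x ∈ closure Q, f x = ⟪g, x⟫ + b) (hne : (Q ∩ {x | t < f x}).Nonempty)
    (ℓ : EuclideanSpace ℝ (Fin 3) × ℝ) (hℓ : ℓ = (‖-g‖⁻¹ • (-g), ‖-g‖⁻¹ * (b - t)))
    (J' : Finset (EuclideanSpace ℝ (Fin 3) × ℝ))
    (hJ' : J' = ((insert (-g, b - t) H).filter (fun p => p.1 ≠ 0)).image
      (fun p => (‖p.1‖⁻¹ • p.1, ‖p.1‖⁻¹ * p.2)))
    (U V : EuclideanSpace ℝ (Fin 3)) (hU : ‖U‖ = 1) (hV : ‖V‖ = 1) (hUV : ⟪U, V⟫ = 0)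
    (haU : ⟪ℓ.1, U⟫ = 0) (haV : ⟪ℓ.1, V⟫ = 0) :
    volume ((fun y : ℝ × ℝ => ℓ.2 • ℓ.1 + y.1 • U + y.2 • V) ⁻¹'
        {x : EuclideanSpace ℝ (Fin 3) | ⟪ℓ.1, x⟫ = ℓ.2 ∧ ∀ c' ∈ J', c' ≠ ℓ → ⟪c'.1, x⟫ < c'.2}) =
      volume {x : EuclideanSpace ℝ (Fin 3) | ∃ y ∈ closure Q ∩ {x | f x = t},
        ∃ τ ∈ Set.Icc (0 : ℝ) 1, x = y + τ • (-(‖g‖⁻¹ • g))} := by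
  classical
  set q : EuclideanSpace ℝ (Fin 3) × ℝ := (-g, b - t) with hq
  have hq0 : q.1 ≠ 0 := by simpa [hq] using hg
  have hℓ1 : ℓ.1 = ‖-g‖⁻¹ • (-g) := by rw [hℓ]
  have hℓ2 : ℓ.2 = ‖-g‖⁻¹ * (b - t) := by rw [hℓ]
  have hℓ1' : ℓ.1 = -(‖g‖⁻¹ • g) := by rw [hℓ1, norm_neg, smul_neg]
  have hng : 0 < ‖-g‖ := by rw [norm_neg]; exact norm_pos_iff.2 hg
  -- the piece as an open polytope, its normal form
  have hP : Q ∩ {x | t < f x} = ⋂ p ∈ insert q H, {x : EuclideanSpace ℝ (Fin 3) | ⟪p.1, x⟫ < p.2} :=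
    inter_superlevel_eq_openHPolytope_insert H hQ g b t hf
  have hne' : (⋂ p ∈ insert q H, {x : EuclideanSpace ℝ (Fin 3) | ⟪p.1, x⟫ < p.2}).Nonempty := by
    rw [← hP]; exact hne
  set J : Finset (EuclideanSpace ℝ (Fin 3) × ℝ) :=
    (H.filter (fun p => p.1 ≠ 0)).image (fun p => (‖p.1‖⁻¹ • p.1, ‖p.1‖⁻¹ * p.2)) with hJ
  have hJ'eq : J' = insert ℓ J := by
    rw [hJ', normalForm_insert_of_ne_zero H q hq0, hℓ]
  have hℓJ' : ℓ ∈ J' := by rw [hJ'eq]; exact Finset.mem_insert_self _ _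
  have h1 : ∀ c ∈ J', ‖c.1‖ = 1 := fun c hc =>
    norm_eq_one_of_mem_normalForm (insert q H) (by rw [← hJ']; exact hc)
  have hnd : ∀ c ∈ J', ∀ c' ∈ J', c ≠ c' → ¬ ∃ μ : ℝ, c'.1 = μ • c.1 ∧ c'.2 = μ * c.2 :=
    fun c hc c' hc' hcc' => not_proportional_of_mem_normalForm (insert q H) hne'
      (by rw [← hJ']; exact hc) (by rw [← hJ']; exact hc') hcc'
  -- the cell itself: nonempty, closure in normal form
  have hQne : Q.Nonempty := hne.mono Set.inter_subset_left
  obtain ⟨-, -, -, hclQ⟩ := cell_normalForm (fun _ : Fin 1 => H) (fun _ => Q) (fun _ => hQ)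
    (fun _ => J) (fun _ => rfl) (i := 0) hQne
  -- the chart lands in the level plane
  have hplane : ∀ y : ℝ × ℝ, ⟪ℓ.1, ℓ.2 • ℓ.1 + y.1 • U + y.2 • V⟫ = ℓ.2 :=
    fun y => inner_chart_base_eq U V ℓ.1 ℓ.2 (h1 ℓ hℓJ') haU haV y
  have hlevel : ∀ x, x ∈ closure Q → (⟪ℓ.1, x⟫ = ℓ.2 ↔ f x = t) := by
    intro x hx
    rw [hf x hx, hℓ1, hℓ2, real_inner_smul_left, inner_neg_left]
    constructor
    · intro h
      have := mul_left_cancel₀ (inv_ne_zero hng.ne') h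
      linarith
    · intro h
      congr 1
      linarith
  -- left-hand side: open facet ~ closed polytope ~ closure Q in the chart
  rw [← measure_congr (chartPreimage_closedHPolytope_ae_eq_openFacet J' h1 hnd hℓJ' U V hU hV hUV
    haU haV)]
  have hL : (fun y : ℝ × ℝ => ℓ.2 • ℓ.1 + y.1 • U + y.2 • V) ⁻¹'
      (⋂ c' ∈ J', {x : EuclideanSpace ℝ (Fin 3) | ⟪c'.1, x⟫ ≤ c'.2}) =
      (fun y : ℝ × ℝ => ℓ.2 • ℓ.1 + y.1 • U + y.2 • V) ⁻¹' closure Q := by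
    rw [hJ'eq, Finset.set_biInter_insert, Set.preimage_inter]
    change _ ∩ _ ⁻¹' (⋂ c' ∈ J, {x : EuclideanSpace ℝ (Fin 3) | ⟪c'.1, x⟫ ≤ c'.2}) = _
    rw [← hclQ, Set.inter_eq_right]
    intro y _
    exact (hplane y).le
  rw [hL]
  -- right-hand side: prism volume = chart area of `closure Q ∩ {f = t}` = chart area of `closure Q`
  have hF : ∀ y ∈ closure Q ∩ {x | f x = t}, ⟪ℓ.1, y⟫ = ⟪ℓ.1, ℓ.2 • ℓ.1⟫ := by
    rintro y ⟨hy, hyt⟩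
    rw [real_inner_smul_right, real_inner_self_eq_norm_sq, h1 ℓ hℓJ', one_pow, mul_one]
    exact (hlevel y hy).2 hyt
  rw [← hℓ1', volume_prism_eq_volume_chartPreimage (h1 ℓ hℓJ') hU hV hUV haU haV hF]
  congr 1
  ext y
  simp only [Set.mem_preimage, Set.mem_setOf_eq, Set.mem_inter_iff]
  constructor
  · intro hy
    exact ⟨hy, (hlevel _ hy).1 (hplane y)⟩
  · intro hy
    exact hy.1

/-- **An empty piece has a null level face (general position).**  If `Q ∩ {f > t} = ∅`, `g ≠ 0`,
and the level plane `{⟪g, ·⟫ + b = t}` is not a facet plane of the cell, then the prism over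
`closure Q ∩ {f = t}` is Lebesgue-null (the face lies in finitely many lines of the level plane).
[cite: Maggi2012, Remark 20.3 p. 258; EvansGariepy2015, Thm 5.16 — plumbing] -/
theorem volume_prism_levelFacet_eq_zero_of_inter_eq_empty
    (H : Finset (EuclideanSpace ℝ (Fin 3) × ℝ)) {Q : Set (EuclideanSpace ℝ (Fin 3))}
    (hQ : Q = ⋂ p ∈ H, {x : EuclideanSpace ℝ (Fin 3) | ⟪p.1, x⟫ < p.2})
    (g : EuclideanSpace ℝ (Fin 3)) (hg : g ≠ 0) (b t : ℝ) {f : EuclideanSpace ℝ (Fin 3) → ℝ}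
    (hf : ∀ x ∈ closure Q, f x = ⟪g, x⟫ + b) (hempty : Q ∩ {x | t < f x} = ∅)
    (hgen : ∀ p ∈ H, {x : EuclideanSpace ℝ (Fin 3) | ⟪g, x⟫ + b = t} ≠ {x | ⟪p.1, x⟫ = p.2}) :
    volume {x : EuclideanSpace ℝ (Fin 3) | ∃ y ∈ closure Q ∩ {x | f x = t},
      ∃ τ ∈ Set.Icc (0 : ℝ) 1, x = y + τ • (-(‖g‖⁻¹ • g))} = 0 := by
  classical
  rcases Set.eq_empty_or_nonempty Q with hQe | hQne
  · have : {x : EuclideanSpace ℝ (Fin 3) | ∃ y ∈ closure Q ∩ {x | f x = t},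
        ∃ τ ∈ Set.Icc (0 : ℝ) 1, x = y + τ • (-(‖g‖⁻¹ • g))} = ∅ := by
      rw [hQe, closure_empty, Set.empty_inter]
      ext x
      simp
    rw [this, measure_empty]
  set ℓ : EuclideanSpace ℝ (Fin 3) × ℝ := (‖-g‖⁻¹ • (-g), ‖-g‖⁻¹ * (b - t)) with hℓ
  have hng : 0 < ‖-g‖ := by rw [norm_neg]; exact norm_pos_iff.2 hg
  have hℓ1' : ℓ.1 = -(‖g‖⁻¹ • g) := by rw [hℓ, norm_neg, smul_neg]
  have h1ℓ : ‖ℓ.1‖ = 1 := by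
    rw [hℓ1', norm_neg, norm_smul, norm_inv, norm_norm, inv_mul_cancel₀ (norm_pos_iff.2 hg).ne']
  obtain ⟨U, V, hU, hV, hUV, haU, haV⟩ := exists_orthonormal_pair_perp ℓ.1
  have hlevel : ∀ x, x ∈ closure Q → (⟪ℓ.1, x⟫ = ℓ.2 ↔ f x = t) := by
    intro x hx
    rw [hf x hx, hℓ]
    simp only [real_inner_smul_left, inner_neg_left]
    constructor
    · intro h
      have := mul_left_cancel₀ (inv_ne_zero hng.ne') h
      linarith
    · intro h
      congr 1
      linarith
  have hplane : ∀ y : ℝ × ℝ, ⟪ℓ.1, ℓ.2 • ℓ.1 + y.1 • U + y.2 • V⟫ = ℓ.2 :=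
    fun y => inner_chart_base_eq U V ℓ.1 ℓ.2 h1ℓ haU haV y
  have hF : ∀ y ∈ closure Q ∩ {x | f x = t}, ⟪ℓ.1, y⟫ = ⟪ℓ.1, ℓ.2 • ℓ.1⟫ := by
    rintro y ⟨hy, hyt⟩
    rw [real_inner_smul_right, real_inner_self_eq_norm_sq, h1ℓ, one_pow, mul_one]
    exact (hlevel y hy).2 hyt
  rw [← hℓ1', volume_prism_eq_volume_chartPreimage h1ℓ hU hV hUV haU haV hF]
  -- the cell's closure in normal form; the face lies in the union of the facet planes
  set J : Finset (EuclideanSpace ℝ (Fin 3) × ℝ) :=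
    (H.filter (fun p => p.1 ≠ 0)).image (fun p => (‖p.1‖⁻¹ • p.1, ‖p.1‖⁻¹ * p.2)) with hJ
  obtain ⟨hQJ, -, -, hclQ⟩ := cell_normalForm (fun _ : Fin 1 => H) (fun _ => Q) (fun _ => hQ)
    (fun _ => J) (fun _ => rfl) (i := 0) hQne
  have hQo : IsOpen Q := by rw [hQ]; exact isOpen_openHPolytope H
  have hcover : {y : ℝ × ℝ | ℓ.2 • ℓ.1 + y.1 • U + y.2 • V ∈ closure Q ∩ {x | f x = t}} ⊆
      ⋃ c ∈ J, (fun y : ℝ × ℝ => ℓ.2 • ℓ.1 + y.1 • U + y.2 • V) ⁻¹'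
        {x : EuclideanSpace ℝ (Fin 3) | ⟪c.1, x⟫ = c.2} := by
    intro y hy
    obtain ⟨hyQ, hyt⟩ := hy
    by_contra hcon
    simp only [Set.mem_iUnion, Set.mem_preimage, Set.mem_setOf_eq, not_exists] at hcon
    set z : EuclideanSpace ℝ (Fin 3) := ℓ.2 • ℓ.1 + y.1 • U + y.2 • V with hz
    have hzcl : z ∈ ⋂ c ∈ J, {x : EuclideanSpace ℝ (Fin 3) | ⟪c.1, x⟫ ≤ c.2} := by
      rw [← hclQ]; exact hyQ
    simp only [Set.mem_iInter, Set.mem_setOf_eq] at hzcl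
    have hzQ : z ∈ Q := by
      rw [hQJ]
      simp only [Set.mem_iInter, Set.mem_setOf_eq]
      intro c hc
      exact lt_of_le_of_ne (hzcl c hc) (hcon c hc)
    -- push `z` inside `Q` along `g`: the value of `f` increases above `t`
    obtain ⟨ε, hε, hballQ⟩ := Metric.isOpen_iff.1 hQo z hzQ
    set s : ℝ := ε / (2 * ‖g‖) with hs
    have hgpos : 0 < ‖g‖ := norm_pos_iff.2 hg
    have hspos : 0 < s := by rw [hs]; positivity
    have hz'Q : z + s • g ∈ Q := by
      apply hballQ
      rw [Metric.mem_ball, dist_eq_norm, add_sub_cancel_left, norm_smul, Real.norm_eq_abs,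
        abs_of_pos hspos, hs]
      field_simp
      linarith
    have hz't : t < f (z + s • g) := by
      rw [hf _ (subset_closure hz'Q), inner_add_right, real_inner_smul_right,
        real_inner_self_eq_norm_sq]
      have hfz : f z = t := hyt
      rw [hf _ hyQ] at hfz
      have hsg : 0 < s * ‖g‖ ^ 2 := by positivity
      linarith
    have : z + s • g ∈ Q ∩ {x | t < f x} := ⟨hz'Q, hz't⟩
    rw [hempty] at this
    exact this
  refine measure_mono_null hcover ?_
  refine (measure_biUnion_null_iff J.countable_toSet).2 fun c hc => ?_
  have hnp := not_proportional_levelConstraint H g hg b t hgen (c := c) hc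
  exact volume_chartPreimage_plane_eq_zero ℓ c U V h1ℓ hU hV hUV haU haV hnp

end Literature.Analysis.Convexity

end
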